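import Literature.NumberTheory.EllipticCurves.MastellaZerman2026.HowardDivisibilityScalarImage
import Literature.NumberTheory.EllipticCurves.TateModuleBaseChange
import Literature.NumberTheory.EllipticCurves.ZpExtensionProofs
import Mathlib.NumberTheory.Padics.Hensel
import HarnessLib

/-!
# Scalars in the `p`-adic image survive restriction to the anticyclotomic tower

Topic `NumberTheory/EllipticCurves`. THEOREMS ONLY (no `def`, no named fact, no instance, no `sorry`).

For an elliptic curve `E/ℚ` (model `W`), an odd prime `p`, an imaginary quadratic field `K` and an
ANTICYCLOTOMIC `ℤ_p`-extension `K_∞/K` (`κ : ZpExtension K p`, `κ.IsAnticyclotomic`,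
`Gal(K̄/K_∞) = κ.kerSubgroup`): if the image of `Γ_ℚ` in `Aut_{ℤ_p}(T_pE)` contains the scalars
`1 + pℤ_p` (Mastella–Zerman 2026, Assumption 2.13 (v); tree predicate `MastellaZerman2026.HasPadicScalarImage`),
then so does the image of `Γ_{K_∞} = Gal(K̄/K_∞)` acting on `T_p(E/K)`
(`exists_mem_kerSubgroup_galoisRepTate_eq_smul_one_of_hasPadicScalarImage`). Elementary group theory,
recorded because it is the form in which the scalar hypothesis is consumed by Kolyvagin-system arguments
over the anticyclotomic tower at ANY class number of `K` (the specialisations `T_pE ⊗ Λ/𝔮` of the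
`Λ`-adic representation are `Γ_K`-modules twisted by a character of `Gal(K_∞/K)`; an element of
`Γ_{K_∞}` acting on `T_pE` as the scalar `α` acts on every such specialisation as the scalar `α`):
cell `pub/bsd-print-x9`, crux card `specialise-first-mu-x10b` supplement S2, seat `bsd-line-x9-p1-w2`.

Proof. (1) `Γ_ℚ → Γ_K`: `res : Γ_K → Γ_ℚ` has image of index `≤ 2` (`inv_mul_mem_range_absGaloisRestrict`),
so `g² ∈ res(Γ_K)` for every `g ∈ Γ_ℚ`; a scalar `b` at `g` gives the scalar `b²` at some `σ ∈ Γ_K`,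
transported to `T_p(E/K)` along the equivariant identification `T_pE ≅ T_p(E/K)` (`tateModuleEquiv_smul`).
(2) `Γ_K → Γ_{K_∞}`: for `ρ ∈ Γ_ℚ ∖ res(Γ_K)` and `σ ∈ Γ_K` acting as the scalar `c`, the conjugate
`τ = ρσρ⁻¹ ∈ Γ_K` again acts as `c` (scalars are central) and `κ τ = (κ σ)⁻¹` (anticyclotomic), so
`στ ∈ ker κ` acts as `c²`. (3) Every `a ≡ 1 (mod p)` is a fourth power `b⁴`, `b ≡ 1 (mod p)`, for `p` odd
(Hensel). No class-number, ramification or reduction hypothesis enters.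

References: L. Mastella, F. Zerman, *On anticyclotomic Euler and Kolyvagin systems*, Ann. Math. Québec
(2026) = arXiv:2505.08710, Assumption 2.13 (v), Lemma 2.39; R. Greenberg, *Iwasawa theory for elliptic
curves*, LNM 1716 (1999), §1 (anticyclotomic `ℤ_p`-extensions); J.-P. Serre, *Cours d'arithmétique*, II §3
(Hensel; squares and powers in `1 + pℤ_p`); L. Washington, *Introduction to Cyclotomic Fields*, §13.1.
-/

noncomputable section

open scoped Classical
open Polynomial

namespace Literature.NumberTheory.EllipticCurves

open WeierstrassCurve GaloisRepresentations MastellaZerman2026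

/-! ## §1 Hensel: `e`-th roots in `1 + pℤ_p` for `p ∤ e` -/

/-- For `a ≡ 1 (mod p)` and `p ∤ e`, `a` has an `e`-th root `b ≡ 1 (mod p)` in `ℤ_p` (Hensel's lemma for
`X^e − a` at `1`: `‖1 − a‖ < 1 = ‖e‖²`; same computation as the private helper of
`MastellaZerman2026/HasPadicScalarImageOfIrreducibleProofs`). [cite: Serre1973, Ch. II §3 (Hensel; powers in 1 + pℤ_p)]
[folklore] -/
theorem padicInt_exists_pow_eq_and_dvd_sub_one {p : ℕ} [Fact p.Prime] {a : ℤ_[p]}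
    (ha : (p : ℤ_[p]) ∣ a - 1) {e : ℕ} (he : ¬ p ∣ e) :
    ∃ b : ℤ_[p], (p : ℤ_[p]) ∣ b - 1 ∧ b ^ e = a := by
  set F : Polynomial ℤ_[p] := X ^ e - C a with hF
  have hF1 : F.aeval (1 : ℤ_[p]) = 1 - a := by simp [hF]
  have hF'1 : F.derivative.aeval (1 : ℤ_[p]) = (e : ℤ_[p]) := by
    simp [hF, derivative_X_pow]
  have hne : ‖F.derivative.aeval (1 : ℤ_[p])‖ = 1 := by
    rw [hF'1, PadicInt.norm_natCast_eq_one_iff]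
    exact (Nat.Prime.coprime_iff_not_dvd Fact.out).mpr he
  have hnorm : ‖F.aeval (1 : ℤ_[p])‖ < ‖F.derivative.aeval (1 : ℤ_[p])‖ ^ 2 := by
    rw [hne, one_pow, hF1, PadicInt.norm_lt_one_iff_dvd, show (1 : ℤ_[p]) - a = -(a - 1) by ring,
      dvd_neg]
    exact ha
  obtain ⟨z, hz, hz1, -, -⟩ := hensels_lemma hnorm
  refine ⟨z, ?_, ?_⟩
  · rw [hne, PadicInt.norm_lt_one_iff_dvd] at hz1
    exact hz1
  · have : z ^ e - a = 0 := by simpa [hF] using hz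
    exact sub_eq_zero.mp this

/-! ## §2 Scalars on `T_pE` versus `T_p(E/K)` along `res : Γ_K → Γ_ℚ` -/

section Scalars

variable {K : Type} [Field K] [NumberField K] (W : WeierstrassCurve ℚ) [W.IsElliptic]
  (p : ℕ) [Fact p.Prime]

/-- If `res σ ∈ Γ_ℚ` acts on `T_pE` as the scalar `c`, then `σ ∈ Γ_K` acts on `T_p(E/K)` as the scalar `c`
(transport along the `res`-equivariant isomorphism `T_pE ≅ T_p(E/K)`, `tateModuleEquiv_smul`).
[cite: SilvermanAEC2009, III.§7 and VII.§4 (T_ℓ(E) as a module for a subgroup of the Galois group)] -/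
theorem galoisRepTate_baseChange_eq_smul_one_of_absGaloisRestrict {σ : Field.absoluteGaloisGroup K}
    {c : ℤ_[p]} (h : galoisRepTate W p (absGaloisRestrict ℚ K σ) = c • 1) :
    galoisRepTate (W.baseChange K) p σ = c • 1 := by
  refine LinearMap.ext fun a ↦ ?_
  obtain ⟨x, rfl⟩ := (tateModuleEquiv W K p).surjective a
  have hx : absGaloisRestrict ℚ K σ • x = c • x := by
    have := LinearMap.congr_fun h x
    simpa only [galoisRepTate_apply_apply, LinearMap.smul_apply, Module.End.one_apply] using this
  rw [galoisRepTate_apply_apply, LinearMap.smul_apply, Module.End.one_apply, ← tateModuleEquiv_smul, hx,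
    map_smul]

/-- Conversely, if `σ ∈ Γ_K` acts on `T_p(E/K)` as the scalar `c`, then `res σ` acts on `T_pE` as the scalar `c`.
[cite: SilvermanAEC2009, III.§7 and VII.§4] -/
theorem galoisRepTate_absGaloisRestrict_eq_smul_one {σ : Field.absoluteGaloisGroup K} {c : ℤ_[p]}
    (h : galoisRepTate (W.baseChange K) p σ = c • 1) :
    galoisRepTate W p (absGaloisRestrict ℚ K σ) = c • 1 := by
  refine LinearMap.ext fun x ↦ ?_
  have hx : σ • tateModuleEquiv W K p x = c • tateModuleEquiv W K p x := by
    have := LinearMap.congr_fun h (tateModuleEquiv W K p x)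
    simpa only [galoisRepTate_apply_apply, LinearMap.smul_apply, Module.End.one_apply] using this
  rw [galoisRepTate_apply_apply, LinearMap.smul_apply, Module.End.one_apply]
  apply (tateModuleEquiv W K p).injective
  rw [tateModuleEquiv_smul, hx, map_smul]

/-- **Step (1): squares of `Γ_ℚ`-scalars are `Γ_K`-scalars.** If `[K : ℚ] = 2` and some `g ∈ Γ_ℚ` acts on
`T_pE` as the scalar `b`, then some `σ ∈ Γ_K` acts on `T_p(E/K)` as `b²` (`g² ∈ res(Γ_K)`: the image of
`Γ_K` has index at most two, `inv_mul_mem_range_absGaloisRestrict`). [cite: MastellaZerman2026, Assumption 2.13 (v)]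
[folklore] -/
theorem exists_galoisRepTate_baseChange_eq_sq_smul_one (h2 : Module.finrank ℚ K = 2) {b : ℤ_[p]}
    (hb : b • (1 : Module.End ℤ_[p] (W.tateModule p)) ∈ Set.range (galoisRepTate W p)) :
    ∃ σ : Field.absoluteGaloisGroup K, galoisRepTate (W.baseChange K) p σ = (b * b) • 1 := by
  obtain ⟨g, hg⟩ := hb
  have hgg : galoisRepTate W p (g * g) = (b * b) • 1 := by
    rw [map_mul, hg]
    refine LinearMap.ext fun x ↦ ?_
    simp only [Module.End.mul_apply, LinearMap.smul_apply, Module.End.one_apply, mul_smul]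
  have hmem : g * g ∈ Set.range (absGaloisRestrict ℚ K) := by
    by_cases hgr : g ∈ Set.range (absGaloisRestrict ℚ K)
    · obtain ⟨s, hs⟩ := hgr
      exact ⟨s * s, by rw [map_mul, hs]⟩
    · have hgi : g⁻¹ ∉ Set.range (absGaloisRestrict ℚ K) := by
        rintro ⟨s, hs⟩
        exact hgr ⟨s⁻¹, by rw [map_inv, hs, inv_inv]⟩
      have h := inv_mul_mem_range_absGaloisRestrict h2 hgi hgr
      rwa [inv_inv] at h
  obtain ⟨σ, hσ⟩ := hmem
  refine ⟨σ, galoisRepTate_baseChange_eq_smul_one_of_absGaloisRestrict W p ?_⟩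
  rw [hσ]
  exact hgg

/-- **Scalars on `T_p(E/K)` for `K` quadratic, from scalars on `T_pE`** (`p` odd): every `a ≡ 1 (mod p)` is a
square `b²` with `b ≡ 1 (mod p)` (Hensel), and `b²` is a `Γ_K`-scalar by
`exists_galoisRepTate_baseChange_eq_sq_smul_one`. [cite: MastellaZerman2026, Assumption 2.13 (v) and §4.1]
[folklore] -/
theorem exists_galoisRepTate_baseChange_eq_smul_one_of_hasPadicScalarImage (h2 : Module.finrank ℚ K = 2)
    (hp : p ≠ 2) (hsc : HasPadicScalarImage W p) {a : ℤ_[p]} (ha : (p : ℤ_[p]) ∣ a - 1) :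
    ∃ σ : Field.absoluteGaloisGroup K, galoisRepTate (W.baseChange K) p σ = a • 1 := by
  have hp' : p.Prime := Fact.out
  have h2' : ¬ p ∣ 2 := fun h ↦ hp ((Nat.prime_dvd_prime_iff_eq hp' Nat.prime_two).mp h)
  obtain ⟨b, hb1, hb⟩ := padicInt_exists_pow_eq_and_dvd_sub_one ha h2'
  obtain ⟨σ, hσ⟩ := exists_galoisRepTate_baseChange_eq_sq_smul_one W p h2 (hsc b hb1)
  refine ⟨σ, ?_⟩
  rw [hσ, ← hb, sq]

/-! ## §3 The anticyclotomic step: `Γ_K`-scalars squared are `Γ_{K_∞}`-scalars -/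

/-- **Step (2): for an anticyclotomic `κ`, if `σ ∈ Γ_K` acts on `T_p(E/K)` as the scalar `c`, some
`τ' ∈ ker κ = Gal(K̄/K_∞)` acts as `c²`.** Take `ρ ∈ Γ_ℚ ∖ res(Γ_K)` (complex conjugation,
`exists_not_mem_range_absGaloisRestrict`) and `τ ∈ Γ_K` with `res τ = ρ (res σ) ρ⁻¹` (index two); `τ` acts as
`c` (a conjugate of a scalar) and `κ τ = (κ σ)⁻¹` (`IsAnticyclotomic`), so `τ' = σ τ`.
[cite: GreenbergLNM1716, §1 (anticyclotomic ℤ_p-extensions: Gal(K/ℚ) acts on Γ by −1)] [folklore] -/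
theorem exists_mem_kerSubgroup_galoisRepTate_eq_sq_smul_one (hK : IsImaginaryQuadratic K)
    (κ : ZpExtension K p) (hκ : κ.IsAnticyclotomic) {σ : Field.absoluteGaloisGroup K} {c : ℤ_[p]}
    (hσ : galoisRepTate (W.baseChange K) p σ = c • 1) :
    ∃ τ ∈ κ.kerSubgroup, galoisRepTate (W.baseChange K) p τ = (c * c) • 1 := by
  haveI : NumberField.IsTotallyComplex K := hK.2
  obtain ⟨ρ, hρ, -⟩ := exists_not_mem_range_absGaloisRestrict (K := ℚ) K (Rat.castHom ℝ)
    NumberField.IsTotallyComplex.isComplex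
  -- `τ ∈ Γ_K` with `res τ = ρ (res σ) ρ⁻¹`
  have h1 : (ρ * absGaloisRestrict ℚ K σ)⁻¹ ∉ Set.range (absGaloisRestrict ℚ K) := by
    rintro ⟨s, hs⟩
    refine hρ ⟨s⁻¹ * σ⁻¹, ?_⟩
    rw [map_mul, map_inv, map_inv, hs]
    group
  have h2 : ρ⁻¹ ∉ Set.range (absGaloisRestrict ℚ K) := by
    rintro ⟨s, hs⟩
    exact hρ ⟨s⁻¹, by rw [map_inv, hs, inv_inv]⟩
  obtain ⟨τ, hτ⟩ := inv_mul_mem_range_absGaloisRestrict hK.1 h1 h2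
  have hτ' : absGaloisRestrict ℚ K τ = ρ * absGaloisRestrict ℚ K σ * ρ⁻¹ := by
    rw [hτ, inv_inv]
  have hκτ : κ τ = (κ σ)⁻¹ := hκ σ τ ρ hρ hτ'
  -- `τ` acts as the scalar `c`
  have hrσ : galoisRepTate W p (absGaloisRestrict ℚ K σ) = c • 1 :=
    galoisRepTate_absGaloisRestrict_eq_smul_one W p hσ
  have hrτ : galoisRepTate W p (absGaloisRestrict ℚ K τ) = c • 1 := by
    rw [hτ', map_mul, map_mul, hrσ]
    refine LinearMap.ext fun x ↦ ?_
    have hinv : galoisRepTate W p ρ (galoisRepTate W p ρ⁻¹ x) = x := by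
      rw [← Module.End.mul_apply, ← map_mul, mul_inv_cancel, map_one, Module.End.one_apply]
    simp only [Module.End.mul_apply, LinearMap.smul_apply, Module.End.one_apply, map_smul, hinv]
  have hτK : galoisRepTate (W.baseChange K) p τ = c • 1 :=
    galoisRepTate_baseChange_eq_smul_one_of_absGaloisRestrict W p hrτ
  refine ⟨σ * τ, ?_, ?_⟩
  · rw [ZpExtension.mem_kerSubgroup, map_mul, hκτ, mul_inv_cancel]
  · rw [map_mul, hσ, hτK]
    refine LinearMap.ext fun x ↦ ?_
    simp only [Module.End.mul_apply, LinearMap.smul_apply, Module.End.one_apply, mul_smul]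

/-- **Scalars `1 + pℤ_p` in the image of `Γ_{K_∞}`.** For `E/ℚ` with `1 + pℤ_p ⊆ ρ_{E,p^∞}(Γ_ℚ)`
(`HasPadicScalarImage W p`), `p` odd, `K` imaginary quadratic and `κ` an anticyclotomic `ℤ_p`-extension of `K`:
every `a ≡ 1 (mod p)` is `ρ_{E/K,p^∞}(τ)` for some `τ ∈ Gal(K̄/K_∞) = ker κ` (`a = b⁴` by Hensel; `b²` is a
`Γ_K`-scalar by step (1); its square is a `Γ_{K_∞}`-scalar by step (2)). The form in which Mastella–Zerman's
Assumption 2.13 (v) is used for the specialised modules `T_pE ⊗ Λ/𝔮` over the anticyclotomic tower; NO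
hypothesis on the class number of `K`. [cite: MastellaZerman2026, Assumption 2.13 (v), Lemma 2.39]
[cite: GreenbergLNM1716, §1] -/
theorem exists_mem_kerSubgroup_galoisRepTate_eq_smul_one_of_hasPadicScalarImage
    (hK : IsImaginaryQuadratic K) (hp : p ≠ 2) (κ : ZpExtension K p) (hκ : κ.IsAnticyclotomic)
    (hsc : HasPadicScalarImage W p) {a : ℤ_[p]} (ha : (p : ℤ_[p]) ∣ a - 1) :
    ∃ τ ∈ κ.kerSubgroup, galoisRepTate (W.baseChange K) p τ = a • 1 := by
  have hp' : p.Prime := Fact.out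
  have h4 : ¬ p ∣ 4 := fun h ↦
    hp ((Nat.prime_dvd_prime_iff_eq hp' Nat.prime_two).mp (hp'.dvd_of_dvd_pow (show p ∣ 2 ^ 2 from h)))
  obtain ⟨b, hb1, hb⟩ := padicInt_exists_pow_eq_and_dvd_sub_one ha h4
  obtain ⟨σ, hσ⟩ := exists_galoisRepTate_baseChange_eq_sq_smul_one W p hK.1 (hsc b hb1)
  obtain ⟨τ, hτ, hτe⟩ := exists_mem_kerSubgroup_galoisRepTate_eq_sq_smul_one W p hK κ hκ hσ
  refine ⟨τ, hτ, ?_⟩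
  rw [hτe, ← hb]
  congr 1
  ring

end Scalars

end Literature.NumberTheory.EllipticCurves

end
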